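import Literature.Geometry.Riemannian.SlicePartialDerivatives
import Literature.Geometry.Riemannian.ConjugateHeatConservation
import Literature.Geometry.Riemannian.RicciFlowRegularity
import Literature.Geometry.Riemannian.RicciFlowScalarCurvatureRegularity
import Literature.Geometry.Lorentzian.ChartLaplacian
import HarnessLib

/-!
# The Laplace–Beltrami operator of a smooth family of metrics on a smooth family of functions
# is smooth on space-time

Topping 2006 works under the convention of §1.2.3 ("`g(t)` is a smooth family of smooth metrics
… smooth all the way to `t = 0` and `t = T`"), under which every space-time expression in the
metric and in smooth space-time functions — `Δ_{g(t)} f(t)`, `|∇f(t)|²_{g(t)}`, … — is again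
smooth on `M × [0, T]`; this is used silently in the entropy computation of §8.2 (Prop. 8.2.6:
`□* v` for `v = [τ(2Δf − |∇f|² + R) + f − n] u`). In the tree a smooth family is
`IsContMDiffFamilyOn ∞ g S` (`RicciFlow.lean`: `(x, t) ↦ g_t(x)` is `C^∞` on `M × S` as a section
of the bundle of bilinear forms) and a smooth space-time function is `f : ℝ → M → ℝ` with
`(x, t) ↦ f t x` of class `C^∞` on `M × S`. This file PROVES, for time sets `S` with unique
derivatives (intervals) and boundaryless models:

* `contDiffOn_chart_of_contMDiffOn_source_prod` — chart reading of a function smooth on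
  `(chart domain) × S`;
* `IsContMDiffFamilyOn.contDiffOn_gram_chart` — the metric coefficients
  `(y, t) ↦ g_t(∂ᵢ, ∂ⱼ)(φ⁻¹ y)` are `C^∞` on `φ.target × S`;
* `IsContMDiffFamilyOn.contMDiffOn_laplaceBeltrami` — **`(x, t) ↦ Δ_{g(t)} (f t) (x)` is `C^∞` on
  `M × S`**: in the chart at `x₀` it is the coordinate expression
  `∑ᵢⱼ Ĝ⁻¹ᵢⱼ (∂ᵢ∂ⱼ f̂ − ∑ₗ Γˡᵢⱼ ∂ₗ f̂)` of `dalembertian_eq_sum_localFrame` (`ChartLaplacian.lean`)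
  in the representatives `Ĝ(y, t)`, `f̂(y, t)`, all of whose ingredients — inverse Gram matrix
  (`contMDiffWithinAt_matrix_inv`), spatial partial derivatives of `Ĝ` and `f̂` of first and
  second order (`SlicePartialDerivatives.lean`) — are `C^∞` on `φ.target × S`;
* `IsContMDiffFamilyOn.contMDiffOn_gradSq` — **`(x, t) ↦ |∇ f(t)|²_{g(t)} (x)` is `C^∞` on
  `M × S`** (`innerDual_mvfderiv_eq_sum_localFrame`).

Everything is proved; no definitions, no named facts.

## References

* P. Topping, *Lectures on the Ricci flow*, LMS Lecture Note Series 325, CUP 2006, §1.2.3 and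
  §8.2, Prop. 8.2.6. [Topping2006]
* B. O'Neill, *Semi-Riemannian geometry*, Academic Press 1983, Ch. 3, Def. 3.50 ff. (Laplacian
  and gradient in coordinates). [ONeill1983]
-/

noncomputable section

open Set Function Filter Manifold Bundle
open scoped Manifold ContDiff Topology

namespace Literature.Geometry.Riemannian

open Lorentzian Lorentzian.PseudoRiemannianMetric

variable {E : Type*} [NormedAddCommGroup E] [NormedSpace ℝ E]
  {H : Type*} [TopologicalSpace H] {I : ModelWithCorners ℝ E H}
  {M : Type*} [TopologicalSpace M] [ChartedSpace H M] [IsManifold I ∞ M]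

/-! ### Chart reading of functions smooth on `(chart domain) × S` -/

/-- **Chart reading on a chart domain**: if `(x, t) ↦ w t x` is `C^k` on
`(chartAt H x₀).source ×ˢ S`, then `(y, t) ↦ w t (φ⁻¹ y)` is `C^k` on `φ.target ×ˢ S`,
`φ = extChartAt I x₀` (the written-in-charts form in the product chart `φ × id`; the version of
`contDiffOn_time_chart` for functions only defined near `x₀`). [folklore] -/
theorem contDiffOn_chart_of_contMDiffOn_source_prod {k : ℕ∞} {w : ℝ → M → ℝ} {S : Set ℝ}
    (x₀ : M)
    (hw : ContMDiffOn (I.prod 𝓘(ℝ, ℝ)) 𝓘(ℝ, ℝ) k (fun p : M × ℝ ↦ w p.2 p.1)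
      ((chartAt H x₀).source ×ˢ S)) :
    ContDiffOn ℝ k (fun q : E × ℝ ↦ w q.2 ((extChartAt I x₀).symm q.1))
      ((extChartAt I x₀).target ×ˢ S) := by
  have h := (contMDiffOn_iff.1 hw).2 (x₀, (0 : ℝ)) (0 : ℝ)
  refine (h.mono ?_).congr ?_
  · rintro ⟨y, s⟩ ⟨hy, hs⟩
    have hy' : (extChartAt I x₀).symm y ∈ (chartAt H x₀).source := by
      rw [← extChartAt_source I]; exact (extChartAt I x₀).map_target hy
    simp only [extChartAt_prod, mem_inter_iff, mem_preimage, mem_prod]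
    refine ⟨⟨hy, ?_⟩, ⟨?_, ?_⟩, ?_⟩
    · simp
    · simpa using hy'
    · simpa using hs
    · simp
  · rintro ⟨y, s⟩ ⟨-, -⟩
    simp only [Function.comp_apply, extChartAt_prod, PartialEquiv.prod_symm,
      PartialEquiv.prod_coe, extChartAt_model_space_eq_id, PartialEquiv.refl_symm,
      PartialEquiv.refl_coe, id_eq]

/-! ### The metric coefficients of a smooth family in a chart -/

section Gram

variable {g : ℝ → PseudoRiemannianMetric I ∞ E (TangentSpace I : M → Type _)} {S : Set ℝ}

/-- **The metric coefficients of a smooth family are `C^∞` on `φ.target × S`**: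
`(y, t) ↦ g_t(φ⁻¹ y)(∂ᵢ, ∂ⱼ)` with `∂ᵢ` the local frame of the trivialization at `x₀`
(`IsContMDiffFamilyOn.contMDiffOn_val_localFrame` read in the product chart).
[cite: Topping2006, §1.2.3] -/
theorem IsContMDiffFamilyOn.contDiffOn_gram_chart (hg : IsContMDiffFamilyOn ∞ g S) (x₀ : M)
    {ι : Type*} (b : Module.Basis ι ℝ E) (i j : ι) :
    ContDiffOn ℝ ∞ (fun q : E × ℝ ↦ (g q.2).val ((extChartAt I x₀).symm q.1)
      ((trivializationAt E (TangentSpace I) x₀).localFrame b i ((extChartAt I x₀).symm q.1))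
      ((trivializationAt E (TangentSpace I) x₀).localFrame b j ((extChartAt I x₀).symm q.1)))
      ((extChartAt I x₀).target ×ˢ S) := by
  have h := hg.contMDiffOn_val_localFrame (trivializationAt E (TangentSpace I) x₀) b i j
  rw [TangentBundle.trivializationAt_baseSet] at h
  exact contDiffOn_chart_of_contMDiffOn_source_prod (k := (⊤ : ℕ∞))
    (w := fun t x ↦ (g t).val x ((trivializationAt E (TangentSpace I) x₀).localFrame b i x)
      ((trivializationAt E (TangentSpace I) x₀).localFrame b j x)) x₀ h

end Gram

/-! ### Smoothness of the Laplacian and of the gradient square of a smooth family -/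

section Laplacian

variable [FiniteDimensional ℝ E] [CompleteSpace E] [I.Boundaryless]
  {g : ℝ → PseudoRiemannianMetric I ∞ E (TangentSpace I : M → Type _)} {S : Set ℝ}

omit [FiniteDimensional ℝ E] [CompleteSpace E] [I.Boundaryless] in
/-- The map `(x, t) ↦ (φ x, t)` is `C^∞` on `φ.source × S` into `E × ℝ`. [folklore] -/
theorem contMDiffOn_extChartAt_prod_id (x₀ : M) (S : Set ℝ) :
    ContMDiffOn (I.prod 𝓘(ℝ, ℝ)) 𝓘(ℝ, E × ℝ) ∞
      (fun z : M × ℝ ↦ (extChartAt I x₀ z.1, z.2)) ((extChartAt I x₀).source ×ˢ S) := by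
  intro z hz
  have h1 : ContMDiffWithinAt (I.prod 𝓘(ℝ, ℝ)) 𝓘(ℝ, E) ∞ (fun z : M × ℝ ↦ extChartAt I x₀ z.1)
      ((extChartAt I x₀).source ×ˢ S) z := by
    have hsrc : z.1 ∈ (chartAt H x₀).source := by
      simpa only [extChartAt_source] using hz.1
    exact ((contMDiffOn_extChartAt (I := I) (n := ∞) (x := x₀)) z.1 hsrc).comp z
      contMDiffWithinAt_fst (fun w hw ↦ by simpa only [extChartAt_source] using hw.1)
  exact h1.prodMk_space contMDiffWithinAt_snd

omit [IsManifold I ∞ M] [FiniteDimensional ℝ E] [CompleteSpace E] [I.Boundaryless] in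
/-- `φ.source × S` is a neighbourhood of `(x₀, t₀)` within `M × S`, `t₀ ∈ S`. [folklore] -/
theorem extChartAt_source_prod_mem_nhdsWithin (x₀ : M) {S : Set ℝ} {t₀ : ℝ} :
    (extChartAt I x₀).source ×ˢ S ∈ 𝓝[univ ×ˢ S] (x₀, t₀) := by
  have h1 : (extChartAt I x₀).source ×ˢ (univ : Set ℝ) ∈ 𝓝 (x₀, t₀) :=
    prod_mem_nhds (extChartAt_source_mem_nhds x₀) univ_mem
  have h2 : (extChartAt I x₀).source ×ˢ S =
      (univ ×ˢ S) ∩ ((extChartAt I x₀).source ×ˢ (univ : Set ℝ)) := by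
    ext z; simp only [mem_prod, mem_univ, true_and, and_true, mem_inter_iff]; tauto
  rw [h2]
  exact inter_mem_nhdsWithin _ h1

/-- **The Laplace–Beltrami operator of a smooth family applied to a smooth space-time function is
smooth on space-time** (Topping 2006, §1.2.3 convention; O'Neill 1983, Ch. 3, Def. 3.50 ff. for
the coordinate formula): if `g` is a family of `C^∞` metrics `C^∞` on `M × S`
(`IsContMDiffFamilyOn ∞ g S`), `S` has unique derivatives, and `(x, t) ↦ f t x` is `C^∞` on
`M × S`, then `(x, t) ↦ Δ_{g(t)} (f t) (x)` (`laplaceBeltrami`) is `C^∞` on `M × S`. In the chart at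
`x₀` this is `∑ᵢⱼ Ĝ⁻¹ᵢⱼ (∂ᵢ∂ⱼ f̂ − ∑ₗ (∑ₖ ½(∂ᵢĜ_{jk} + ∂ⱼĜ_{ik} − ∂ₖĜ_{ij}) Ĝ⁻¹ₖₗ) ∂ₗ f̂)` evaluated at
`(φ x, t)` (`dalembertian_eq_sum_localFrame`), a `C^∞` function of `(y, t)` on `φ.target × S`.
[cite: Topping2006, §1.2.3] [cite: ONeill1983, Ch. 3, Def. 3.50 ff.] -/
theorem IsContMDiffFamilyOn.contMDiffOn_laplaceBeltrami (hg : IsContMDiffFamilyOn ∞ g S)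
    (hS : UniqueDiffOn ℝ S) {f : ℝ → M → ℝ}
    (hf : ContMDiffOn (I.prod 𝓘(ℝ, ℝ)) 𝓘(ℝ, ℝ) ∞ (fun p : M × ℝ ↦ f p.2 p.1) (univ ×ˢ S)) :
    ContMDiffOn (I.prod 𝓘(ℝ, ℝ)) 𝓘(ℝ, ℝ) ∞
      (fun p : M × ℝ ↦ (g p.2).laplaceBeltrami (f p.2) p.1) (univ ×ˢ S) := by
  classical
  rintro ⟨x₀, t₀⟩ ⟨-, ht₀⟩
  obtain ⟨b⟩ : Nonempty (Module.Basis (Fin (Module.finrank ℝ E)) ℝ E) := ⟨Module.finBasis ℝ E⟩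
  set φ := extChartAt I x₀ with hφ
  set e := trivializationAt E (TangentSpace I) x₀ with he
  have hV : IsOpen φ.target := isOpen_extChartAt_target x₀
  -- the ingredients, `C^∞` on `φ.target × S`
  have hG : ∀ i j, ContDiffOn ℝ ∞ (fun q : E × ℝ ↦ (g q.2).val (φ.symm q.1)
      (e.localFrame b i (φ.symm q.1)) (e.localFrame b j (φ.symm q.1))) (φ.target ×ˢ S) :=
    fun i j ↦ hg.contDiffOn_gram_chart x₀ b i j
  have hGinv : ∀ i j, ContDiffOn ℝ ∞ (fun q : E × ℝ ↦ (Matrix.of fun i j ↦ (g q.2).val (φ.symm q.1)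
      (e.localFrame b i (φ.symm q.1)) (e.localFrame b j (φ.symm q.1)))⁻¹ i j) (φ.target ×ˢ S) := by
    intro i j q hq
    have h := contMDiffWithinAt_matrix_inv (J := 𝓘(ℝ, E × ℝ)) (k := ∞)
      (A := fun q : E × ℝ ↦ Matrix.of fun i j ↦ (g q.2).val (φ.symm q.1)
        (e.localFrame b i (φ.symm q.1)) (e.localFrame b j (φ.symm q.1)))
      (s := φ.target ×ˢ S) (x₀ := q)
      (fun i j ↦ contMDiffWithinAt_iff_contDiffWithinAt.2 (hG i j q hq))
      (det_gram_comp_extChartAt_symm_ne_zero b (g q.2) hq.1) i j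
    exact contMDiffWithinAt_iff_contDiffWithinAt.1 h
  have hdG : ∀ i j (v : E), ContDiffOn ℝ ∞ (fun q : E × ℝ ↦ fderiv ℝ (fun z ↦ (g q.2).val (φ.symm z)
      (e.localFrame b i (φ.symm z)) (e.localFrame b j (φ.symm z))) q.1 v) (φ.target ×ˢ S) :=
    fun i j v ↦ contDiffOn_fderiv_slice_apply hV hS (hG i j) v
  have hfh : ContDiffOn ℝ ∞ (fun q : E × ℝ ↦ f q.2 (φ.symm q.1)) (φ.target ×ˢ S) :=
    contDiffOn_time_chart (k := (⊤ : ℕ∞)) hf x₀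
  have hdf : ∀ v : E, ContDiffOn ℝ ∞ (fun q : E × ℝ ↦ fderiv ℝ (f q.2 ∘ φ.symm) q.1 v)
      (φ.target ×ˢ S) := fun v ↦ contDiffOn_fderiv_slice_apply hV hS hfh v
  have hd2f : ∀ v w : E, ContDiffOn ℝ ∞
      (fun q : E × ℝ ↦ fderiv ℝ (fderiv ℝ (f q.2 ∘ φ.symm)) q.1 v w) (φ.target ×ˢ S) :=
    fun v w ↦ contDiffOn_fderiv_fderiv_slice_apply hV hS hfh v w
  -- the coordinate expression of `Δ_{g t} (f t)` in `(y, t)`, `C^∞` on `φ.target × S`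
  set Λ : E × ℝ → ℝ := fun q ↦ ∑ i, ∑ j,
      (Matrix.of fun i j ↦ (g q.2).val (φ.symm q.1)
        (e.localFrame b i (φ.symm q.1)) (e.localFrame b j (φ.symm q.1)))⁻¹ i j *
      (fderiv ℝ (fderiv ℝ (f q.2 ∘ φ.symm)) q.1 (b i) (b j) -
        ∑ l, (∑ k, 2⁻¹ *
          (fderiv ℝ (fun z ↦ (g q.2).val (φ.symm z)
              (e.localFrame b j (φ.symm z)) (e.localFrame b k (φ.symm z))) q.1 (b i) +
            fderiv ℝ (fun z ↦ (g q.2).val (φ.symm z)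
              (e.localFrame b i (φ.symm z)) (e.localFrame b k (φ.symm z))) q.1 (b j) -
            fderiv ℝ (fun z ↦ (g q.2).val (φ.symm z)
              (e.localFrame b i (φ.symm z)) (e.localFrame b j (φ.symm z))) q.1 (b k)) *
          (Matrix.of fun i j ↦ (g q.2).val (φ.symm q.1)
            (e.localFrame b i (φ.symm q.1)) (e.localFrame b j (φ.symm q.1)))⁻¹ k l) *
          fderiv ℝ (f q.2 ∘ φ.symm) q.1 (b l)) with hΛ
  have hΛs : ContDiffOn ℝ ∞ Λ (φ.target ×ˢ S) := by
    refine ContDiffOn.sum fun i _ ↦ ContDiffOn.sum fun j _ ↦ ?_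
    refine (hGinv i j).mul ((hd2f (b i) (b j)).sub ?_)
    refine ContDiffOn.sum fun l _ ↦ ?_
    refine (ContDiffOn.sum fun k _ ↦ ?_).mul (hdf (b l))
    exact (contDiffOn_const.mul (((hdG j k (b i)).add (hdG i k (b j))).sub (hdG i j (b k)))).mul
      (hGinv k l)
  -- compose with `(x, t) ↦ (φ x, t)`
  have hmaps : (φ.source ×ˢ S) ⊆ (fun z : M × ℝ ↦ (φ z.1, z.2)) ⁻¹' (φ.target ×ˢ S) :=
    fun z hz ↦ ⟨φ.map_source hz.1, hz.2⟩
  have hmem : (x₀, t₀) ∈ φ.source ×ˢ S := ⟨mem_extChartAt_source x₀, ht₀⟩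
  have hcomp : ContMDiffWithinAt (I.prod 𝓘(ℝ, ℝ)) 𝓘(ℝ, ℝ) ∞ (Λ ∘ fun z : M × ℝ ↦ (φ z.1, z.2))
      (φ.source ×ˢ S) (x₀, t₀) :=
    ContDiffWithinAt.comp_contMDiffWithinAt (f := fun z : M × ℝ ↦ (φ z.1, z.2)) (x := (x₀, t₀))
      (hΛs _ (hmaps hmem)) (contMDiffOn_extChartAt_prod_id x₀ S _ hmem) hmaps
  -- the coordinate formula: `Δ_{g t} (f t) (x) = Λ (φ x, t)` on `φ.source × S`
  have hagree : ∀ z ∈ φ.source ×ˢ S, (g z.2).laplaceBeltrami (f z.2) z.1 =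
      (Λ ∘ fun z : M × ℝ ↦ (φ z.1, z.2)) z := by
    rintro ⟨x, t⟩ ⟨hx, ht⟩
    have hp : x ∈ (chartAt H x₀).source := by simpa only [hφ, extChartAt_source] using hx
    have hf2 : CMDiffAt 2 (f t) x :=
      ((contMDiff_slice_of_contMDiffOn hf ht).of_le (by norm_cast)) x
    haveI := (g t).hasLeviCivita
    rw [laplaceBeltrami_eq_dalembertian]
    exact dalembertian_eq_sum_localFrame (g t) b hp hf2
      (Eventually.of_forall fun _ _ _ ↦ rfl) EventuallyEq.rfl
  have hloc : ContMDiffWithinAt (I.prod 𝓘(ℝ, ℝ)) 𝓘(ℝ, ℝ) ∞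
      (fun p : M × ℝ ↦ (g p.2).laplaceBeltrami (f p.2) p.1) (φ.source ×ˢ S) (x₀, t₀) :=
    hcomp.congr (fun z hz ↦ hagree z hz) (hagree _ hmem)
  exact hloc.mono_of_mem_nhdsWithin (extChartAt_source_prod_mem_nhdsWithin x₀)

omit [CompleteSpace E] in
/-- **The gradient square of a smooth space-time function along a smooth family is smooth on
space-time**: `(x, t) ↦ |∇ f(t)|²_{g(t)} (x) = g(t)⁻¹(df(t), df(t))(x)` (`gradSq`) is `C^∞` on
`M × S` (in the chart: `∑ᵢⱼ Ĝ⁻¹ᵢⱼ ∂ᵢf̂ ∂ⱼf̂`, `innerDual_mvfderiv_eq_sum_localFrame`; O'Neill 1983,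
Ch. 3, p. 85). [cite: Topping2006, §1.2.3] [cite: ONeill1983, Ch. 3, p. 85] -/
theorem IsContMDiffFamilyOn.contMDiffOn_gradSq (hg : IsContMDiffFamilyOn ∞ g S)
    (hS : UniqueDiffOn ℝ S) {f : ℝ → M → ℝ}
    (hf : ContMDiffOn (I.prod 𝓘(ℝ, ℝ)) 𝓘(ℝ, ℝ) ∞ (fun p : M × ℝ ↦ f p.2 p.1) (univ ×ˢ S)) :
    ContMDiffOn (I.prod 𝓘(ℝ, ℝ)) 𝓘(ℝ, ℝ) ∞
      (fun p : M × ℝ ↦ (g p.2).gradSq (f p.2) p.1) (univ ×ˢ S) := by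
  classical
  rintro ⟨x₀, t₀⟩ ⟨-, ht₀⟩
  obtain ⟨b⟩ : Nonempty (Module.Basis (Fin (Module.finrank ℝ E)) ℝ E) := ⟨Module.finBasis ℝ E⟩
  set φ := extChartAt I x₀ with hφ
  set e := trivializationAt E (TangentSpace I) x₀ with he
  have hV : IsOpen φ.target := isOpen_extChartAt_target x₀
  have hG : ∀ i j, ContDiffOn ℝ ∞ (fun q : E × ℝ ↦ (g q.2).val (φ.symm q.1)
      (e.localFrame b i (φ.symm q.1)) (e.localFrame b j (φ.symm q.1))) (φ.target ×ˢ S) :=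
    fun i j ↦ hg.contDiffOn_gram_chart x₀ b i j
  have hGinv : ∀ i j, ContDiffOn ℝ ∞ (fun q : E × ℝ ↦ (Matrix.of fun i j ↦ (g q.2).val (φ.symm q.1)
      (e.localFrame b i (φ.symm q.1)) (e.localFrame b j (φ.symm q.1)))⁻¹ i j) (φ.target ×ˢ S) := by
    intro i j q hq
    have h := contMDiffWithinAt_matrix_inv (J := 𝓘(ℝ, E × ℝ)) (k := ∞)
      (A := fun q : E × ℝ ↦ Matrix.of fun i j ↦ (g q.2).val (φ.symm q.1)
        (e.localFrame b i (φ.symm q.1)) (e.localFrame b j (φ.symm q.1)))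
      (s := φ.target ×ˢ S) (x₀ := q)
      (fun i j ↦ contMDiffWithinAt_iff_contDiffWithinAt.2 (hG i j q hq))
      (det_gram_comp_extChartAt_symm_ne_zero b (g q.2) hq.1) i j
    exact contMDiffWithinAt_iff_contDiffWithinAt.1 h
  have hfh : ContDiffOn ℝ ∞ (fun q : E × ℝ ↦ f q.2 (φ.symm q.1)) (φ.target ×ˢ S) :=
    contDiffOn_time_chart (k := (⊤ : ℕ∞)) hf x₀
  have hdf : ∀ v : E, ContDiffOn ℝ ∞ (fun q : E × ℝ ↦ fderiv ℝ (f q.2 ∘ φ.symm) q.1 v)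
      (φ.target ×ˢ S) := fun v ↦ contDiffOn_fderiv_slice_apply hV hS hfh v
  set Λ : E × ℝ → ℝ := fun q ↦ ∑ i, ∑ j,
      (Matrix.of fun i j ↦ (g q.2).val (φ.symm q.1)
        (e.localFrame b i (φ.symm q.1)) (e.localFrame b j (φ.symm q.1)))⁻¹ i j *
      fderiv ℝ (f q.2 ∘ φ.symm) q.1 (b i) * fderiv ℝ (f q.2 ∘ φ.symm) q.1 (b j) with hΛ
  have hΛs : ContDiffOn ℝ ∞ Λ (φ.target ×ˢ S) := by
    refine ContDiffOn.sum fun i _ ↦ ContDiffOn.sum fun j _ ↦ ?_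
    exact ((hGinv i j).mul (hdf (b i))).mul (hdf (b j))
  have hmaps : (φ.source ×ˢ S) ⊆ (fun z : M × ℝ ↦ (φ z.1, z.2)) ⁻¹' (φ.target ×ˢ S) :=
    fun z hz ↦ ⟨φ.map_source hz.1, hz.2⟩
  have hmem : (x₀, t₀) ∈ φ.source ×ˢ S := ⟨mem_extChartAt_source x₀, ht₀⟩
  have hcomp : ContMDiffWithinAt (I.prod 𝓘(ℝ, ℝ)) 𝓘(ℝ, ℝ) ∞ (Λ ∘ fun z : M × ℝ ↦ (φ z.1, z.2))
      (φ.source ×ˢ S) (x₀, t₀) :=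
    ContDiffWithinAt.comp_contMDiffWithinAt (f := fun z : M × ℝ ↦ (φ z.1, z.2)) (x := (x₀, t₀))
      (hΛs _ (hmaps hmem)) (contMDiffOn_extChartAt_prod_id x₀ S _ hmem) hmaps
  have hagree : ∀ z ∈ φ.source ×ˢ S, (g z.2).gradSq (f z.2) z.1 =
      (Λ ∘ fun z : M × ℝ ↦ (φ z.1, z.2)) z := by
    rintro ⟨x, t⟩ ⟨hx, ht⟩
    have hp : x ∈ (chartAt H x₀).source := by simpa only [hφ, extChartAt_source] using hx
    have hf1 : MDifferentiableAt I 𝓘(ℝ, ℝ) (f t) x :=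
      ((contMDiff_slice_of_contMDiffOn hf ht) x).mdifferentiableAt (by simp)
    show (g t).gradSq (f t) x = Λ (φ x, t)
    simp only [hΛ, PseudoRiemannianMetric.gradSq]
    rw [φ.left_inv hx]
    exact innerDual_mvfderiv_eq_sum_localFrame (g t) b hp hf1 hf1 EventuallyEq.rfl
      EventuallyEq.rfl
  have hloc : ContMDiffWithinAt (I.prod 𝓘(ℝ, ℝ)) 𝓘(ℝ, ℝ) ∞
      (fun p : M × ℝ ↦ (g p.2).gradSq (f p.2) p.1) (φ.source ×ˢ S) (x₀, t₀) :=
    hcomp.congr (fun z hz ↦ hagree z hz) (hagree _ hmem)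
  exact hloc.mono_of_mem_nhdsWithin (extChartAt_source_prod_mem_nhdsWithin x₀)

end Laplacian

end Literature.Geometry.Riemannian

end
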